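import Summits.NavierStokesRegularity.NavierStokesRegularity.Theorems.ExtremiserTransienceNearExtremalTransienceExtremiserLiouvilleConstantSpeedMultiplierStrongEL
import HarnessLib

/-!
# Crux `ExtremiserTransience.NearExtremalTransience` (stmt-NavierStokesRegularity-21883), line `extremiser_liouville`,
# stub K1b — THE ANGULAR-MOMENT (VIRIAL) IDENTITY OF THE EULER–LAGRANGE DENSITY: a multiplier-free necessary condition

`--supports stmt-NavierStokesRegularity-21883` (helper).  Author: prover seat `ns-el-k1b` (g3).

Testing the curl-form Euler–Lagrange equation `G dx = curl(vμ)` (`…ConstantSpeedMultiplierHelicity.multiplier_curl_identity`)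
with the truncated rotation fields `η_R = χ_R · (e × x)` (`χ_R` the tree's cut-off, `curl(e × x) = 2e`,
`curl(χ_R · (e×x)) = 2χ_R e + (Dχ_R·x) e − (Dχ_R·e) x`, the correction supported on the annulus `R ≤ ‖x‖ ≤ 2R` where
`|Dχ_R| ‖x‖ ≤ 2C`), dominated convergence in the finite measure `μ` gives

* `tendsto_integral_density_cutoff_cross` : **`∫ χ_R(x) ⟪G(x), e × x⟫ dx ⟶ 2 ∫ ⟪v, e⟫ dμ`** (`R → ∞`) for every `e ∈ ℝ³`
  — the principal-value ANGULAR MOMENT of the E–L density about `e` is twice the `e`-component of the multiplier's barycentre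
  `b = ∫ v dμ`;
* `residue_angularMoment_farField` : for the K1b residue object, with `e = c` its far field (`‖c‖ = M`, `v − c ∈ L⁶`) and `G`
  the explicit E–L density: **the limit `L_c = lim_R ∫ χ_R ⟪G, c × x⟫ dx` exists and `−S² ≤ L_c ≤ 0`**
  (`L_c = 2∫⟪v,c⟫dμ = 2(M²μ(ℝ³) − S²)`, `S²/(2M²) ≤ μ(ℝ³) ≤ S²/M²` from `…ConstantSpeedMultiplierIdentities`) — a necessary
  condition on `v` ALONE (no multiplier appears): the E–L density of a residue object has NON-POSITIVE angular moment about
  its own far-field direction, of size at most `S²`.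

WHAT THIS IS NOT: a necessary condition on the HYPOTHETICAL K1b residue object; K1b is NOT proved; nothing here proves NS
regularity. [folklore]
-/

noncomputable section

open Set Filter Topology MeasureTheory Metric Function
open scoped ENNReal NNReal Topology InnerProductSpace RealInnerProductSpace ContDiff Laplacian
open Literature.Analysis.FluidPDE Literature.Analysis

namespace Summit.NavierStokesRegularity.NavierStokesRegularity.Theorems

-- the problem directory repeats the summit name (`NavierStokesRegularity/NavierStokesRegularity`)
set_option linter.dupNamespace false

namespace ExtremiserLiouville

open DepletionLadder.KStar DepletionLadder.KStar.HalfSpace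

variable {v G : E3 → E3} {M : ℝ} {μ : Measure E3}

/-! ## The truncated rotation fields `χ_R · (e × x)` -/

/-- `curl (χ · (e × ·)) (x) = 2χ(x) e + (Dχ(x)·x) e − (Dχ(x)·e) x` for a differentiable scalar `χ`. [folklore] -/
theorem curl_smul_cross (e : E3) {χ : E3 → ℝ} {x : E3} (hχ : DifferentiableAt ℝ χ x) :
    curl (fun y => χ y • cross e y) x = (2 * χ x) • e + (fderiv ℝ χ x x) • e - (fderiv ℝ χ x e) • x := by
  have hlin : DifferentiableAt ℝ (fun y => cross e y) x := by
    have : (fun y => cross e y) = fun y => crossCLM e y := funext fun y => (crossCLM_apply e y).symm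
    rw [this]
    exact (crossCLM e).differentiableAt
  rw [curl_smul hχ hlin, curlCLM_smulRight_cross]
  have hc : curl (fun y => cross e y) x = (2 : ℝ) • e := by
    have : (fun y => cross e y) = fun y => crossCLM e y := funext fun y => (crossCLM_apply e y).symm
    rw [this, curl_eq_curlCLM, (crossCLM e).fderiv, curlCLM_crossCLM]
  rw [hc, smul_smul, mul_comm]
  abel

/-- **Angular moment of the E–L density = twice the barycentre of the multiplier**:
`∫ χ_R ⟪G, e × x⟫ dx → 2∫⟪v, e⟫dμ` as `R → ∞`, whenever `G dx = curl(vμ)` on test fields (`hG`, `hμ`), `μ` finite and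
`‖v‖ ≤ M`. [folklore] -/
theorem tendsto_integral_density_cutoff_cross (hv : ContDiff ℝ ∞ v) {M : ℝ} (hM : ∀ x, ‖v x‖ ≤ M)
    (hG : ∀ η : E3 → E3, ContDiff ℝ ∞ η → HasCompactSupport η →
      Jst v * J1 v (curl η) - kStar ^ 2 * M ^ 2 * (Wpa v * A1 v (curl η) + Zen v * C1 v (curl η)) = ∫ x, ⟪G x, η x⟫_ℝ)
    [IsFiniteMeasure μ]
    (hμ : ∀ φ : E3 → E3, ContDiff ℝ ∞ φ → HasCompactSupport φ → VectorCalculus.IsDivFree φ →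
      Jst v * J1 v φ - kStar ^ 2 * M ^ 2 * (Wpa v * A1 v φ + Zen v * C1 v φ) = ∫ x, ⟪v x, φ x⟫_ℝ ∂μ)
    (e : E3) :
    Tendsto (fun R : ℝ => ∫ x, ⟪G x, cutoff R x • cross e x⟫_ℝ) atTop (𝓝 (2 * ∫ x, ⟪v x, e⟫_ℝ ∂μ)) := by
  obtain ⟨C, hC0, hC⟩ := exists_norm_fderiv_cutoff_le (E := E3)
  have hM0 : 0 ≤ M := (norm_nonneg _).trans (hM 0)
  -- for `R > 0` the identity `∫⟪G, η_R⟫ = ∫⟪v, curl η_R⟫dμ`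
  have hlin : ContDiff ℝ ∞ fun y : E3 => cross e y := by
    have : (fun y : E3 => cross e y) = fun y => crossCLM e y := funext fun y => (crossCLM_apply e y).symm
    rw [this]; exact (crossCLM e).contDiff
  have hη : ∀ R, ContDiff ℝ ∞ fun y => cutoff R y • cross e y := fun R => (contDiff_cutoff R).smul hlin
  have hηc : ∀ R, 0 < R → HasCompactSupport fun y => cutoff R y • cross e y := fun R hR =>
    (hasCompactSupport_cutoff hR).smul_right
  have hid : ∀ R, 0 < R → ∫ x, ⟪G x, cutoff R x • cross e x⟫_ℝ =
      ∫ x, ⟪v x, curl (fun y => cutoff R y • cross e y) x⟫_ℝ ∂μ := fun R hR =>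
    multiplier_curl_identity hG hμ (hη R) (hηc R hR)
  -- pointwise form of `⟪v, curl η_R⟫`
  have hcurl : ∀ R x, ⟪v x, curl (fun y => cutoff R y • cross e y) x⟫_ℝ =
      2 * cutoff R x * ⟪v x, e⟫_ℝ + fderiv ℝ (cutoff R) x x * ⟪v x, e⟫_ℝ - fderiv ℝ (cutoff R) x e * ⟪v x, x⟫_ℝ := by
    intro R x
    rw [curl_smul_cross e (((contDiff_cutoff (n := 1) R).differentiable one_ne_zero) x), inner_sub_right, inner_add_right,
      real_inner_smul_right, real_inner_smul_right, real_inner_smul_right]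
  -- dominated convergence in `μ`
  have hlim : Tendsto (fun R : ℝ => ∫ x, ⟪v x, curl (fun y => cutoff R y • cross e y) x⟫_ℝ ∂μ) atTop
      (𝓝 (∫ x, 2 * ⟪v x, e⟫_ℝ ∂μ)) := by
    refine tendsto_integral_filter_of_dominated_convergence (fun _ => 2 * M * ‖e‖ + 2 * C * M * ‖e‖ + 2 * C * ‖e‖ * M)
      ?_ ?_ (integrable_const _) ?_
    · exact Eventually.of_forall fun R =>
        (hv.continuous.inner (contDiff_curl_top (hη R)).continuous).aestronglyMeasurable
    · refine (eventually_gt_atTop 0).mono fun R hR => Eventually.of_forall fun x => ?_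
      rw [hcurl R x]
      have hve : |⟪v x, e⟫_ℝ| ≤ M * ‖e‖ := (abs_real_inner_le_norm _ _).trans (by gcongr; exact hM x)
      have hvx : |⟪v x, x⟫_ℝ| ≤ M * ‖x‖ := (abs_real_inner_le_norm _ _).trans (by gcongr; exact hM x)
      have hχ1 : |cutoff R x| ≤ 1 := abs_cutoff_le_one R x
      -- the derivative terms live on the annulus, where `‖Dχ_R‖ ‖x‖ ≤ 2C`
      have hD : ‖fderiv ℝ (cutoff R) x‖ * ‖x‖ ≤ 2 * C := by
        by_cases hA : R ≤ ‖x‖ ∧ ‖x‖ ≤ 2 * R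
        · calc ‖fderiv ℝ (cutoff R) x‖ * ‖x‖ ≤ (C / R) * (2 * R) := by gcongr; exacts [hC R hR x, hA.2]
            _ = 2 * C := by field_simp
        · rw [(fderiv_cutoff_eq_zero_of_not_mem hR hA).1, norm_zero, zero_mul]; positivity
      have h1 : |2 * cutoff R x * ⟪v x, e⟫_ℝ| ≤ 2 * M * ‖e‖ := by
        rw [abs_mul, abs_mul, abs_two]
        calc 2 * |cutoff R x| * |⟪v x, e⟫_ℝ| ≤ 2 * 1 * (M * ‖e‖) := by gcongr
          _ = 2 * M * ‖e‖ := by ring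
      have h2 : |fderiv ℝ (cutoff R) x x * ⟪v x, e⟫_ℝ| ≤ 2 * C * M * ‖e‖ := by
        rw [abs_mul]
        calc |fderiv ℝ (cutoff R) x x| * |⟪v x, e⟫_ℝ| ≤ (‖fderiv ℝ (cutoff R) x‖ * ‖x‖) * (M * ‖e‖) := by
              gcongr; rw [← Real.norm_eq_abs]; exact (fderiv ℝ (cutoff R) x).le_opNorm x
          _ ≤ 2 * C * (M * ‖e‖) := by gcongr
          _ = 2 * C * M * ‖e‖ := by ring
      have h3 : |fderiv ℝ (cutoff R) x e * ⟪v x, x⟫_ℝ| ≤ 2 * C * ‖e‖ * M := by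
        rw [abs_mul]
        calc |fderiv ℝ (cutoff R) x e| * |⟪v x, x⟫_ℝ| ≤ (‖fderiv ℝ (cutoff R) x‖ * ‖e‖) * (M * ‖x‖) := by
              gcongr; rw [← Real.norm_eq_abs]; exact (fderiv ℝ (cutoff R) x).le_opNorm e
          _ = (‖fderiv ℝ (cutoff R) x‖ * ‖x‖) * ‖e‖ * M := by ring
          _ ≤ 2 * C * ‖e‖ * M := by gcongr
      rw [Real.norm_eq_abs]
      calc |2 * cutoff R x * ⟪v x, e⟫_ℝ + fderiv ℝ (cutoff R) x x * ⟪v x, e⟫_ℝ - fderiv ℝ (cutoff R) x e * ⟪v x, x⟫_ℝ|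
          ≤ |2 * cutoff R x * ⟪v x, e⟫_ℝ + fderiv ℝ (cutoff R) x x * ⟪v x, e⟫_ℝ| + |fderiv ℝ (cutoff R) x e * ⟪v x, x⟫_ℝ| :=
            abs_sub _ _
        _ ≤ (|2 * cutoff R x * ⟪v x, e⟫_ℝ| + |fderiv ℝ (cutoff R) x x * ⟪v x, e⟫_ℝ|) + |fderiv ℝ (cutoff R) x e * ⟪v x, x⟫_ℝ| := by
            gcongr; exact abs_add_le _ _
        _ ≤ 2 * M * ‖e‖ + 2 * C * M * ‖e‖ + 2 * C * ‖e‖ * M := by linarith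
    · refine Eventually.of_forall fun x => ?_
      have hev : ∀ᶠ R : ℝ in atTop, ⟪v x, curl (fun y => cutoff R y • cross e y) x⟫_ℝ = 2 * ⟪v x, e⟫_ℝ := by
        filter_upwards [eventually_gt_atTop ‖x‖] with R hR
        have hR0 : 0 < R := lt_of_le_of_lt (norm_nonneg x) hR
        rw [hcurl R x, cutoff_eq_one hR0 hR.le, (fderiv_cutoff_eq_zero_of_not_mem hR0 (fun h => (not_le.2 hR) h.1)).1]
        simp
      exact (tendsto_const_nhds (x := 2 * ⟪v x, e⟫_ℝ)).congr' (hev.mono fun R hR => hR.symm)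
  rw [integral_const_mul] at hlim
  exact hlim.congr' ((eventually_gt_atTop 0).mono fun R hR => (hid R hR).symm)

/-! ## The multiplier-free angular-moment bound for the residue object -/

/-- **ANGULAR MOMENT OF THE E–L DENSITY ABOUT THE FAR FIELD: `−S² ≤ lim_R ∫χ_R⟪G, c × x⟫dx ≤ 0`.**  For a constant-speed
extended extremiser `v` (K1b residue object) there are a far field `c` (`‖c‖ = M`, `v − c → 0`, `v − c ∈ L⁶`) and, with `G`
the explicit Euler–Lagrange density, a limit `L` of the truncated angular moments `∫χ_R⟪G, c × x⟫dx` with `−S² ≤ L ≤ 0`. [folklore] -/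
theorem residue_angularMoment_farField (hv : ContDiff ℝ ∞ v) (hdiv : VectorCalculus.IsDivFree v) {M B : ℝ}
    (hMpos : 0 < M) (hM : ∀ x, ‖v x‖ = M) (hB : ∀ x, ‖fderiv ℝ v x‖ ≤ B)
    (h1 : ∫⁻ x, ‖iteratedFDeriv ℝ 1 v x‖ₑ ^ 2 < ⊤) (h2 : ∫⁻ x, ‖iteratedFDeriv ℝ 2 v x‖ₑ ^ 2 < ⊤)
    (hatt : |Jst v| = kStar * M * Real.sqrt (Zen v) * Real.sqrt (Wpa v)) :
    ∃ (c : E3) (L : ℝ), ‖c‖ = M ∧ Tendsto (fun x => v x - c) (cocompact E3) (𝓝 0) ∧ MemLp (fun x => v x - c) 6 volume ∧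
      -(Jst v ^ 2) ≤ L ∧ L ≤ 0 ∧
      Tendsto (fun R : ℝ => ∫ x, ⟪(Jst v • (curl (curl (fun y => fderiv ℝ v y (curl v y))) x -
          curl (fun y => fderiv ℝ (curl v) y (curl v y)) x +
          curl (curl (fun y => ∑ j, ⟪curl v y, fderiv ℝ v y (EuclideanSpace.basisFun (Fin 3) ℝ j)⟫_ℝ •
          EuclideanSpace.basisFun (Fin 3) ℝ j)) x) +
        (-(kStar ^ 2 * M ^ 2 * Wpa v)) • curl (curl (curl v)) x -
        (-(kStar ^ 2 * M ^ 2 * Zen v)) • curl (curl (Δ (curl v))) x), cutoff R x • cross c x⟫_ℝ) atTop (𝓝 L) := by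
  obtain ⟨c, μ, hcM, hdec, hmem, hfin, hmass, hlow, hμ, -, -⟩ :=
    exists_multiplierMeasure_farField hv hdiv hMpos hM hB h1 h2 hatt
  have hG : ∀ η : E3 → E3, ContDiff ℝ ∞ η → HasCompactSupport η →
      Jst v * J1 v (curl η) - kStar ^ 2 * M ^ 2 * (Wpa v * A1 v (curl η) + Zen v * C1 v (curl η)) =
        ∫ x, ⟪(Jst v • (curl (curl (fun y => fderiv ℝ v y (curl v y))) x -
          curl (fun y => fderiv ℝ (curl v) y (curl v y)) x +
          curl (curl (fun y => ∑ j, ⟪curl v y, fderiv ℝ v y (EuclideanSpace.basisFun (Fin 3) ℝ j)⟫_ℝ •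
          EuclideanSpace.basisFun (Fin 3) ℝ j)) x) +
        (-(kStar ^ 2 * M ^ 2 * Wpa v)) • curl (curl (curl v)) x -
        (-(kStar ^ 2 * M ^ 2 * Zen v)) • curl (curl (Δ (curl v))) x), η x⟫_ℝ := by
    intro η hη hηc
    rw [← density_formula hv (Jst v) (-(kStar ^ 2 * M ^ 2 * Wpa v)) (-(kStar ^ 2 * M ^ 2 * Zen v)) hη hηc]
    show Jst v * J1 v (curl η) - kStar ^ 2 * M ^ 2 * (Wpa v * A1 v (curl η) + Zen v * C1 v (curl η)) =
      Jst v * J1 v (curl η) + -(kStar ^ 2 * M ^ 2 * Wpa v) * A1 v (curl η) + -(kStar ^ 2 * M ^ 2 * Zen v) * C1 v (curl η)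
    ring
  have hlim := tendsto_integral_density_cutoff_cross hv (fun x => (hM x).le) hG hμ c
  obtain ⟨heq, hle⟩ := multiplier_integral_inner_farField_nonpos hv hdiv hM hB h1 h2 hatt hmem hmass hμ
  refine ⟨c, 2 * ∫ x, ⟪v x, c⟫_ℝ ∂μ, hcM, hdec, hmem, ?_, by linarith, hlim⟩
  rw [heq]
  nlinarith [hlow]

end ExtremiserLiouville

end Summit.NavierStokesRegularity.NavierStokesRegularity.Theorems

end
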